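import Mathlib.Data.ZMod.Basic
import Mathlib.Algebra.Group.Hom.Defs
import Mathlib.Data.Fintype.Prod
import HarnessLib

/-!
# (2,1,1)⁶ in (ℤ/2)⁵ — the X-ROOM CERTIFICATE, part B1: codes of `𝔽₂⁵`, the normal-form maps, the orbit certificates (kernel)

Cell `pub-omega` (unit `pub-omega-stpp-1-g35`), topic `Summits/MatrixMultiplication/OmegaCensus`.
HONEST FRAMING (verbatim): lottery ticket; floor = certified bounds/negative ranges. Census STRUCTURE bookkeeping (B5, T1 column at `(ℤ/2)⁵`);
nothing here is a bound on `ω`.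

* `G5 = ℤ/2 × ℤ/2 × ℤ/2 × ℤ/2 × ℤ/2`, the 5-bit code `enc : G5 → ℕ` (additive for `Nat.xor`, injective, `< 32`) and its inverse `dec` on
  `[0, 32)`; the basis vectors `u j = dec 2ʲ`.
* THE NORMAL-FORM MAPS `phi j v : G5 →+ G5` (`j < 5`, any `v`): additive and injective; when `2ʲ ≤ enc v` the map sends `v ↦ u j` and FIXES
  every `x` with `enc x < 2ʲ` (the span of `u 0 … u (j−1)`). Explicitly `x ↦ swapᵢⱼ(x + xᵢ v) + xᵢ u j` with `i` the top bit of `enc v`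
  (on codes: `phiC`); all four properties are `decide`d by the kernel over the 5 · 32 · 32 · 32 cases.
* THE ORBIT CERTIFICATES `certs`: for each of the 18 normal-form 6-subsets `{0} ∪ {u l : l < d} ∪ R` (`R ⊆ span_d`, `#R = 5 − d`,
  `d = 3, 4, 5`) of `𝔽₂⁵` a shift `t` and a linear map (images `h` of `u 0 … u 4`, `lin h`) carrying it onto one of the four representative
  code sets `reps = {0,1,2,4,5,6}, {0,1,2,4,8,10}, {0,1,2,4,8,15}, {0,1,2,4,8,16}` (`certs_cover`, kernel); each listed map is additive and
  injective (`certs_hom`, kernel); and `span_d` has at most 4 elements for `d ≤ 2` (`card_span_le`). Found by the seat's `certs.py`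
  (BFS over transvections), checked here by the kernel only.

References: H. Cohn, R. Kleinberg, B. Szegedy, C. Umans, FOCS 2005 (arXiv:math/0511460), Def. 5.1.
-/

namespace Summit.MatrixMultiplication.OmegaCensus

namespace T1Z2p5

open Finset

/-! ## Codes -/

/-- The group `𝔽₂⁵`, right-nested as in the census statements. -/
abbrev G5 : Type := ZMod 2 × ZMod 2 × ZMod 2 × ZMod 2 × ZMod 2

/-- The 5-bit code of an element (first coordinate = bit 4). -/
def enc (x : G5) : ℕ := 16 * x.1.val + (8 * x.2.1.val + (4 * x.2.2.1.val + (2 * x.2.2.2.1.val + x.2.2.2.2.val)))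

/-- The element with a given code (`n < 32`). -/
def dec (n : ℕ) : G5 :=
  (((n / 16 % 2 : ℕ) : ZMod 2), ((n / 8 % 2 : ℕ) : ZMod 2), ((n / 4 % 2 : ℕ) : ZMod 2), ((n / 2 % 2 : ℕ) : ZMod 2), ((n % 2 : ℕ) : ZMod 2))

/-- The basis vector with code `2ʲ`. -/
def u (j : ℕ) : G5 := dec (2 ^ j)

/-- Codes are `< 32`. -/
theorem enc_lt (x : G5) : enc x < 32 := by revert x; decide

/-- `dec` inverts `enc`. -/
theorem dec_enc (x : G5) : dec (enc x) = x := by revert x; decide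

/-- `enc` inverts `dec` on `[0, 32)`. -/
theorem enc_dec : ∀ n < 32, enc (dec n) = n := by decide

/-- `enc` is injective. -/
theorem enc_injective : Function.Injective enc := fun x y h => by rw [← dec_enc x, h, dec_enc]

/-- `enc 0 = 0`. -/
theorem enc_zero : enc 0 = 0 := by decide

/-- Only `0` has code `0`. -/
theorem enc_eq_zero {x : G5} (h : enc x = 0) : x = 0 := enc_injective (h.trans enc_zero.symm)

/-- **Addition is XOR of codes.** -/
theorem enc_add (x y : G5) : enc (x + y) = Nat.xor (enc x) (enc y) := by revert x y; decide

/-- Code of a basis vector. -/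
theorem enc_u : ∀ j < 5, enc (u j) = 2 ^ j := by decide

/-- All codes `< 32` satisfy a Boolean test. -/
def allC (f : ℕ → Bool) : Bool := (List.range 32).all f

/-- Reading a passed `allC` test. -/
theorem allC_spec {f : ℕ → Bool} (h : allC f = true) {x : ℕ} (hx : x < 32) : f x = true :=
  List.all_eq_true.1 h x (List.mem_range.2 hx)

/-- Kernel check: `dec` turns XOR of codes into addition. -/
theorem dec_xor_check : (allC fun a => allC fun b => decide (dec (Nat.xor a b) = dec a + dec b)) = true := by
  decide +kernel

/-- `dec` turns XOR of codes into addition. -/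
theorem dec_xor (a : ℕ) (ha : a < 32) (b : ℕ) (hb : b < 32) : dec (Nat.xor a b) = dec a + dec b :=
  of_decide_eq_true (allC_spec (allC_spec dec_xor_check ha) hb)

/-! ## The normal-form maps -/

/-- The normal-form map on codes (`w` = code of `v`; identity when `w < 2ʲ` or `w ≥ 32`): with `i = log₂ w`, `y = x + xᵢ w`,
swap bits `i` and `j` of `y` (bit `i` of `y` is `0`) and put `xᵢ` into bit `j`. -/
def phiC (j w x : ℕ) : ℕ :=
  if w < 2 ^ j ∨ 32 ≤ w then x else
    let i := Nat.log2 w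
    let y := if x.testBit i then Nat.xor x w else x
    (if y.testBit j then y - 2 ^ j + 2 ^ i else y) + (if x.testBit i then 2 ^ j else 0)

/-- The normal-form map `x ↦ swapᵢⱼ(x + xᵢ v) + xᵢ uⱼ` as a function on `G5`. -/
def phiFun (j : ℕ) (v x : G5) : G5 := dec (phiC j (enc v) (enc x))

/-- KERNEL CHECK of the normal-form maps on codes: for `j < 5` and all codes `w, x, y < 32`: additivity for XOR, codes `< 32`,
injectivity, `w ↦ 2ʲ` and the span of the lower bits fixed (the last two when `2ʲ ≤ w`). -/
theorem phiC_check : (List.range 5).all (fun j => allC fun w => allC fun x => allC fun y =>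
    (phiC j w (Nat.xor x y) == Nat.xor (phiC j w x) (phiC j w y)) && Nat.blt (phiC j w x) 32 &&
    (!(phiC j w x == phiC j w y) || (x == y)) &&
    (Nat.blt w (2 ^ j) || ((phiC j w w == 2 ^ j) && (!(Nat.blt x (2 ^ j)) || (phiC j w x == x))))) = true := by
  decide +kernel

/-- Reading `phiC_check`. -/
theorem phiC_spec {j w x y : ℕ} (hj : j < 5) (hw : w < 32) (hx : x < 32) (hy : y < 32) :
    phiC j w (Nat.xor x y) = Nat.xor (phiC j w x) (phiC j w y) ∧ phiC j w x < 32 ∧ (phiC j w x = phiC j w y → x = y) ∧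
    (2 ^ j ≤ w → phiC j w w = 2 ^ j ∧ (x < 2 ^ j → phiC j w x = x)) := by
  have h := allC_spec (allC_spec (allC_spec (List.all_eq_true.1 phiC_check j (List.mem_range.2 hj)) hw) hx) hy
  simp only [Bool.and_eq_true, beq_iff_eq, Nat.blt_eq, Bool.or_eq_true, Bool.not_eq_true', beq_eq_false_iff_ne,
    ne_eq] at h
  obtain ⟨⟨⟨h1, h2⟩, h3⟩, h4⟩ := h
  refine ⟨h1, h2, fun e => ?_, fun hle => ?_⟩
  · rcases h3 with h3 | h3
    · exact absurd e h3
    · exact h3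
  · rcases h4 with h4 | ⟨h5, h6⟩
    · exact absurd hle (not_le.2 h4)
    · refine ⟨h5, fun hxl => ?_⟩
      rcases h6 with h6 | h6
      · have : ¬ x < 2 ^ j := fun hh => by rw [← Nat.blt_eq] at hh; rw [hh] at h6; exact Bool.noConfusion h6
        exact absurd hxl this
      · exact h6

/-- The normal-form maps are additive. -/
theorem phiFun_add (j : Fin 5) (v x y : G5) : phiFun j v (x + y) = phiFun j v x + phiFun j v y := by
  unfold phiFun
  rw [enc_add, (phiC_spec j.isLt (enc_lt v) (enc_lt x) (enc_lt y)).1,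
    dec_xor _ (phiC_spec j.isLt (enc_lt v) (enc_lt x) (enc_lt y)).2.1 _ (phiC_spec j.isLt (enc_lt v) (enc_lt y) (enc_lt y)).2.1]

/-- The normal-form maps are injective. -/
theorem phiFun_inj (j : Fin 5) (v x y : G5) (h : phiFun j v x = phiFun j v y) : x = y := by
  unfold phiFun at h
  have h' : phiC j (enc v) (enc x) = phiC j (enc v) (enc y) := by
    have := congrArg enc h
    rwa [enc_dec _ (phiC_spec j.isLt (enc_lt v) (enc_lt x) (enc_lt x)).2.1,
      enc_dec _ (phiC_spec j.isLt (enc_lt v) (enc_lt y) (enc_lt y)).2.1] at this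
  exact enc_injective ((phiC_spec j.isLt (enc_lt v) (enc_lt x) (enc_lt y)).2.2.1 h')

/-- The normal-form map sends `v ↦ u j` when `2ʲ ≤ enc v`. -/
theorem phiFun_self (j : Fin 5) (v : G5) (h : 2 ^ j.val ≤ enc v) : phiFun j v v = u j := by
  unfold phiFun u
  rw [((phiC_spec j.isLt (enc_lt v) (enc_lt v) (enc_lt v)).2.2.2 h).1]

/-- The normal-form map fixes the span of `u 0 … u (j−1)` pointwise when `2ʲ ≤ enc v`. -/
theorem phiFun_fix (j : Fin 5) (v x : G5) (h : 2 ^ j.val ≤ enc v) (hx : enc x < 2 ^ j.val) : phiFun j v x = x := by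
  unfold phiFun
  rw [((phiC_spec j.isLt (enc_lt v) (enc_lt x) (enc_lt x)).2.2.2 h).2 hx, dec_enc]

/-- **The normal-form map as a homomorphism.** -/
def phi (j : Fin 5) (v : G5) : G5 →+ G5 := AddMonoidHom.mk' (phiFun j v) (phiFun_add j v)

/-- `phi` is injective. -/
theorem phi_injective (j : Fin 5) (v : G5) : Function.Injective (phi j v) := fun x y h => phiFun_inj j v x y h

/-- `phi j v v = u j`. -/
theorem phi_self (j : Fin 5) {v : G5} (h : 2 ^ j.val ≤ enc v) : phi j v v = u j := phiFun_self j v h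

/-- `phi j v` fixes the span of `u 0 … u (j−1)`. -/
theorem phi_fix (j : Fin 5) {v x : G5} (h : 2 ^ j.val ≤ enc v) (hx : enc x < 2 ^ j.val) : phi j v x = x := phiFun_fix j v x h hx

/-! ## Linear maps from images of the basis, and the orbit certificates -/

/-- The linear map on codes with `u b ↦ h[b]`: XOR of the `h[b]` over the set bits `b < 5` of `x`. -/
def linC (h : List ℕ) (x : ℕ) : ℕ :=
  Nat.xor (Nat.xor (Nat.xor (Nat.xor (if x.testBit 0 then h.getD 0 0 else 0) (if x.testBit 1 then h.getD 1 0 else 0))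
    (if x.testBit 2 then h.getD 2 0 else 0)) (if x.testBit 3 then h.getD 3 0 else 0)) (if x.testBit 4 then h.getD 4 0 else 0)

/-- The linear map with basis images `h`, as a function on `G5`. -/
def linFun (h : List ℕ) (x : G5) : G5 := dec (linC h (enc x))

/-- The four representative `c`-code lists (sorted). -/
def reps : List (List ℕ) := [[0, 1, 2, 4, 5, 6], [0, 1, 2, 4, 8, 10], [0, 1, 2, 4, 8, 15], [0, 1, 2, 4, 8, 16]]

/-- A code list as a set of elements. -/
def setOf (l : List ℕ) : Finset G5 := (l.map dec).toFinset

/-- THE ORBIT CERTIFICATES `(t, h, r)`: shift code `t`, basis images `h`, target representative index `r`. -/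
def certs : List (ℕ × List ℕ × ℕ) :=
  [(0, [4, 2, 5, 8, 16], 0), (0, [1, 4, 6, 8, 16], 0), (0, [6, 2, 5, 8, 16], 0), (0, [1, 2, 4, 8, 16], 0), (0, [1, 2, 5, 8, 16], 0),
   (0, [1, 2, 6, 8, 16], 0), (0, [8, 2, 4, 1, 16], 1), (0, [2, 1, 8, 4, 16], 1), (0, [1, 2, 8, 4, 16], 1), (1, [1, 3, 9, 5, 16], 1),
   (0, [2, 1, 4, 8, 16], 1), (0, [1, 2, 4, 8, 16], 1), (1, [1, 3, 5, 9, 16], 1), (0, [1, 4, 2, 8, 16], 1), (1, [1, 5, 3, 9, 16], 1),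
   (2, [5, 4, 6, 12, 16], 1), (0, [1, 2, 4, 8, 16], 2), (0, [1, 2, 4, 8, 16], 3)]

/-- KERNEL CHECK of the certificate maps on codes: additivity for XOR, codes `< 32`, injectivity. -/
theorem linC_check : certs.all (fun e => allC fun x => allC fun y =>
    (linC e.2.1 (Nat.xor x y) == Nat.xor (linC e.2.1 x) (linC e.2.1 y)) && Nat.blt (linC e.2.1 x) 32 &&
    (!(linC e.2.1 x == linC e.2.1 y) || (x == y))) = true := by
  decide +kernel

/-- Reading `linC_check`. -/
theorem linC_spec {e : ℕ × List ℕ × ℕ} (he : e ∈ certs) {x y : ℕ} (hx : x < 32) (hy : y < 32) :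
    linC e.2.1 (Nat.xor x y) = Nat.xor (linC e.2.1 x) (linC e.2.1 y) ∧ linC e.2.1 x < 32 ∧ (linC e.2.1 x = linC e.2.1 y → x = y) := by
  have h := allC_spec (allC_spec (List.all_eq_true.1 linC_check e he) hx) hy
  simp only [Bool.and_eq_true, beq_iff_eq, Nat.blt_eq, Bool.or_eq_true, Bool.not_eq_true', beq_eq_false_iff_ne, ne_eq] at h
  obtain ⟨⟨h1, h2⟩, h3⟩ := h
  refine ⟨h1, h2, fun e' => ?_⟩
  rcases h3 with h3 | h3
  · exact absurd e' h3
  · exact h3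

/-- Every certificate map is additive and injective. -/
theorem certs_hom (e : ℕ × List ℕ × ℕ) (he : e ∈ certs) :
    (∀ x y : G5, linFun e.2.1 (x + y) = linFun e.2.1 x + linFun e.2.1 y) ∧ Function.Injective (linFun e.2.1) := by
  refine ⟨fun x y => ?_, fun x y h => ?_⟩
  · unfold linFun
    rw [enc_add, (linC_spec he (enc_lt x) (enc_lt y)).1, dec_xor _ (linC_spec he (enc_lt x) (enc_lt x)).2.1 _
      (linC_spec he (enc_lt y) (enc_lt y)).2.1]
  · unfold linFun at h
    have h' : linC e.2.1 (enc x) = linC e.2.1 (enc y) := by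
      have := congrArg enc h
      rwa [enc_dec _ (linC_spec he (enc_lt x) (enc_lt x)).2.1, enc_dec _ (linC_spec he (enc_lt y) (enc_lt y)).2.1] at this
    exact enc_injective ((linC_spec he (enc_lt x) (enc_lt y)).2.2 h')

/-- The certificate map of an entry, as a homomorphism. -/
def lin (e : ℕ × List ℕ × ℕ) (he : e ∈ certs) : G5 →+ G5 := AddMonoidHom.mk' (linFun e.2.1) (certs_hom e he).1

/-- `lin` is injective. -/
theorem lin_injective (e : ℕ × List ℕ × ℕ) (he : e ∈ certs) : Function.Injective (lin e he) := (certs_hom e he).2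

/-- The span of `u 0 … u (d−1)`: elements with code `< 2ᵈ`. -/
def span (d : ℕ) : Finset G5 := univ.filter fun x => enc x < 2 ^ d

/-- The basic elements `{0} ∪ {u l : l < d}` of a normal form. -/
def base (d : ℕ) : Finset G5 := insert 0 ((range d).image u)

/-- The free part of `span d`. -/
def free (d : ℕ) : Finset G5 := span d \ base d

/-- `#(base d) = d + 1` for `d ≤ 5` (kernel check). -/
theorem card_base : ∀ d ∈ range 6, (base d).card = d + 1 := by decide +kernel

/-- `base d ⊆ span d` (kernel check). -/
theorem base_subset_span : ∀ d ∈ range 6, base d ⊆ span d := by decide +kernel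

/-- For `d ≤ 2` the span is too small to hold six points (kernel check). -/
theorem card_span_le : ∀ d ∈ range 3, (span d).card ≤ 4 := by decide +kernel

/-- **THE 18 NORMAL FORMS ARE COVERED:** every `base d ∪ R` with `R ⊆ free d`, `#R = 5 − d`, `d ∈ {3, 4, 5}`, is carried by a listed
certificate (shift by `dec t`, then `lin`) onto a representative code set (kernel check). -/
theorem certs_cover : ∀ d ∈ ({3, 4, 5} : Finset ℕ), ∀ R ∈ (free d).powersetCard (5 - d),
    ∃ e ∈ certs, ((base d ∪ R).image (· + dec e.1)).image (linFun e.2.1) = setOf (reps.getD e.2.2 []) := by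
  decide +kernel

end T1Z2p5

end Summit.MatrixMultiplication.OmegaCensus
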